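import Summits.QuantumFields.BalabanUV.T4Continuum.Support.NE7Route1EndDockedSmallDataSU2EG
import Summits.QuantumFields.BalabanUV.T4Continuum.Support.NE7EnergyGradRateWSU2End
import HarnessLib

/-!
# NE7Route1EndDockedSmallDataSU2Sup — route #1 of the NE7 crux (node U5): THE DOCKED END OVER THE SMALL DATA (SU(2), `L = 2`) WITH THE BACKGROUND-COORDINATE SOCKET `h`∕`h_w`∕`h_EG`
# DISCHARGED — its place taken by ONE PRINTED-TYPE hypothesis on the minimisers: the pointwise flux-gradient regularity `‖∇_U F‖ ≤ c·(spacing)³` of [Balaban1985Variational] Thm 1 (10)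
# ((10) TYPE, for every minimiser of the data class; asserted for no configuration here)

Cell `pub-balaban`, rung (B)+1 sub-cell t4, lineage `b2b-balaban-t4-ne7-p1`, generation 108 (CRUX PROVER NE7 #1 = OWNER of BINDER row NE7).
Memo `t4/b2b-balaban-t4-ne7-p1-g108/ROAD-G108.md` §3.
WHAT ([folklore]; 0 def, 0 sorry).  **`goodClause_summable_of_route1_docked_smallData_SU2Sup`**: the statement of gen 107's
`NE7Route1EndDockedSmallDataSU2EG.goodClause_summable_of_route1_docked_smallData_SU2EG` VERBATIM with the socket `h_EG` (representation ∧ (E) ∧ (Gᶜ_w) for every minimiser pair, constants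
`C, Λ_G`) DELETED and, in its place, the flux-gradient letter `(10) TYPE`: `∀ V ∈ dom, ∀ k U, IsMinimiser … k V U → ∀ x κ π, ‖covGrad U (flux U) x κ π‖ ≤ c∕(L^k)³` (any real `0 ≤ c`).
Proof = that END at the constants `C, Λ_G` of THIS generation's supplier `NE7EnergyGradRateWSU2End.ne3EnergyGradRateWSup_SU2_smallData` (T-E_w♯ + (Gᶜ_w) for every minimiser pair over
the small data, modulo (10) TYPE), the small-data radius shrunk to the minimum of the two.
WHY THIS IS THE END OF THE SUPPLIER LINE (ROAD-G106 §4 → ROAD-G107 §4 → ROAD-G108): the socket of route 1's END asked OUR coordinate `Z` of the pair `(U_A, cavg U_B)` to have an energy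
rate and a covariant-gradient rate; both are now THEOREMS for every minimiser pair over the small data ((E): gen 105; (Gᶜ_w): gens 106–108 — (S-b) the curl's Lipschitz letter from the
radii, (S-d′) the curved C¹ slice letter with the junction logarithm, (S-g′) the normal part's sup letters + the cube-root bootstrap), GIVEN the pointwise flux-gradient regularity of the
two minimisers.  That regularity is Bałaban's printed (10) of [Balaban1985Variational] Thm 1 — a statement about minimisers IN PRINT, where the socket was a statement about our own
construction.  The END's remaining displayed inputs are therefore: (10) TYPE, `hsector`, the data-class binders, and the other rows' (B)(C)(D).
HONEST FRAMING (page 1): composition of landed kernel theorems; (10) TYPE is a HYPOTHESIS (NOT a theorem of the tree; the energy form (9)ᴱ IS — gen 105's (H∀)ᴱ — but the pointwise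
form is not); nothing of Bałaban's asserted as an axiom; nothing of rows NE2∕NE3's ledger items touched; spine count = dagwriter∕referees' call; FIXED FINITE T⁴, rung (B)+1 — NOT
infinite volume, NOT mass gap, NOT BetaPertH, NOT Clay (continuum YM on T⁴ ⇐ BetaPertH ∧ nine spine estimates).
-/


set_option autoImplicit false

open scoped BigOperators Matrix Matrix.Norms.L2Operator
open Finset NormedSpace MeasureTheory

namespace Summit.QuantumFields.BalabanUV.T4Continuum.NE7Route1EndDockedSmallDataSU2Sup

open Literature.MathematicalPhysics.QuantumFieldTheory.Balaban1983to89
open B7Prop1Explicit B7Prop2Explicit B7Prop1Local B11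
open T4AveragingDeficitWall hiding Site Plane Plaq Bond
open T4AveragingDeficitWallBoundary (periodBox IsPeriodicCfg)
open MinimalActionSandwich (IsMinimiser)
open MinimalActionRate (Regular sfClass)
open T4OutputRate (Carriers Functional NE9 NE5 LipBackground FadingMemory)
open T4BoundaryCarrier (BFunctional atFl NE9Fl LipBackgroundFl NE5B)
open T4TowerRateComposition (PolyLipGrowth URateUpTo)
open T4CauchySum (InjectedRate)
open T4RecentScale T4GoodClassBudget T4TermwiseBudget T4TermwiseUN T4TermwiseChainUN
open AveragingDeficitPeriodicCounting (IsPeriodicDir)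
open AveragingDeficitTwoLevelPrep (twoLevelSmall)
open NE3EnergyShapes (residualScale IsUnitarySite IsPeriodicSite)
open NE3EnergyWeightedShapes (energyNormW)
open NE7EtaBackgroundCarrier
open TorusSmallFieldGlobalGauge (sectorConst)
open TermwiseBackground (cReg)
open TermwiseHolder (Realises)
open T4TermwiseTorus (IsPeriodic pbox)
open NE7Route1EndDockedSmallDataSU2EG (goodClause_summable_of_route1_docked_smallData_SU2EG)
open NE7EnergyGradRateWSU2End (ne3EnergyGradRateWSup_SU2_smallData)
open NE7HintUnconditionalSU2 (hint_SU2_small_data)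
open NE7InteriorMinimiserDocking (hminE_of_interior_exists_d4 lines_d4)

noncomputable section

variable {n : Type} [Fintype n] [DecidableEq n] [Nonempty n]

set_option maxHeartbeats 800000 in
/-- **ROUTE #1's DOCKED END OVER THE SMALL DATA (SU(2), `L = 2`), THE BACKGROUND-COORDINATE SOCKET DISCHARGED MODULO (10) TYPE** — statement in the file header. [folklore] -/
theorem goodClause_summable_of_route1_docked_smallData_SU2Sup (hn : Fintype.card n = 2) :
    ∃ ε₀ : ℝ, 0 < ε₀ ∧ ∀ {L N : ℕ}, L = 2 → 1 ≤ N → ∀ {ε : ℝ}, 0 < ε → ε ≤ ε₀ → ∃ δV : ℝ, 0 < δV ∧ ∀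
    -- (A) the bill of NODE O's background coordinate, (H∃) DISCHARGED DOWN TO (8)∃ + ONE numeric `ε`-line (`b = ε`, `g` the explicit letter)
    {θ : ℝ} (hθ : 0 < θ)
    (hθ18 : θ ^ 18 = ((L : ℝ))⁻¹)
    {g : ℝ}
    (hgE : g = (Fintype.card n : ℝ)
          * (624 * ((4 : ℕ) : ℝ) ^ 3 * ε ^ 2 * (1 + (((4 : ℕ) : ℝ) + 1) * ε) ^ 2
              + 6768 * (Fintype.card (T4AveragingDeficitWall.Plane 4) : ℝ) ^ 2 * (4 : ℕ) * Fintype.card n * ε ^ 4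
              + 16 * ((4 : ℕ) : ℝ) ^ 3 * ε ^ 2 * (L : ℝ) ^ 2)
        + 220 * (Fintype.card n : ℝ) * ((4 : ℕ) : ℝ) ^ 3 * ε ^ 3)
    {dom : Set (Site 4 → Fin 4 → (Matrix n n ℂ)ˣ)}
    (hdom : ∀ v ∈ dom, ∀ w : Site 4 → (Matrix n n ℂ)ˣ, IsUnitarySite w → IsPeriodicSite w (N : ℤ) → gaugeAct w v ∈ dom)
    -- (8)∃ is NO LONGER ASKED: the data class sits inside the small data of radius `δV` supplied by `NE7HintUnconditionalSU2.hint_SU2_small_data`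
    (hdomδ : ∀ v ∈ dom, IsUnitaryCfg v ∧ IsPeriodicCfg v (N : ℤ) ∧ SmallField v δV)
    -- THE SOCKET `h`∕`h_w`∕`h_EG` IS NO LONGER ASKED: in its place, (10) TYPE — the pointwise flux-gradient regularity of every minimiser of the data class ([Balaban1985Variational] Thm 1 (10))
    (c : ℝ) (hc : 0 ≤ c)
    (hreg10 : ∀ V ∈ dom, ∀ (k : ℕ) (U : Site 4 → Fin 4 → (Matrix n n ℂ)ˣ), IsMinimiser 4 (sfClass 4 L N ε) L N k V U →
      ∀ (x : Site 4) (κ : Fin 4) (π : T4AveragingDeficitWall.Plane 4), ‖covGrad U (flux U) x κ π‖ ≤ c / ((L : ℝ) ^ k) ^ 3)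
    (hsector : (Fintype.card n : ℝ) * (N : ℝ) ^ 2 * ε ≤ sectorConst n)
    {v₁ : (Site 4 → Fin 4 → (Matrix n n ℂ)ˣ)} (hv₁ : v₁ ∈ dom)
    (D : Type) (sc : D → ℕ) (dl : D → ℝ) (hdl : ∀ X, 0 ≤ dl X) (Fl : Type) (admFl : Set Fl)
    -- (B) window, decay, history moduli, node U2's output on the printed box, the common rate `θ′ ∈ [θ, 1)`
    {W : Set (ℕ → ℝ)} {κ C₉ ω θc Cd γg θ' : ℝ} {Λ : ℕ → ℕ → ℝ} {gA : ℕ → ℕ → ℝ}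
    (hΛ : FadingMemory C₉ ω Λ) (hω : 0 ≤ ω)
    (hinj : InjectedRate Cd 0 θc (fun K j => T4CouplingMatching.disc (gA K) (gA (K + 1)) j)) (hCd : 0 ≤ Cd)
    (hθc : 0 ≤ θc) (hbox : ∀ K i, i ≤ K → 0 < gA K i ∧ gA K i ≤ γg)
    (hgAW : ∀ K, gA K ∈ W) (hgBW : ∀ K, (fun i => gA (K + 1) (i + 1)) ∈ W)
    (hθ' : max ω θc < θ') (hθθ' : θ ≤ θ') (hθ'1 : θ' < 1)
    -- (C) node U3's shapes: E-kind `EA EB`, boundary kind `BA BB`, 𝐑-kind `RA RB` on the boundary carrier over `occCarriers`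
    {EA : Functional ({ toCarriers := occCarriers n L N ε dom D sc dl hdl, Fl := Fl, admFl := admFl } :
        T4BoundaryCarrier.Carriers).toCarriers (occCarriers n L N ε dom D sc dl hdl).BgA}
    {EB : Functional ({ toCarriers := occCarriers n L N ε dom D sc dl hdl, Fl := Fl, admFl := admFl } :
        T4BoundaryCarrier.Carriers).toCarriers (occCarriers n L N ε dom D sc dl hdl).BgB}
    {θ₅ C₅ P : ℝ} {q : ℕ} {CU : (ℕ → ℝ) → ℕ → ℝ}
    (h9 : NE9 EA W κ Λ) (hU : LipBackground EA W κ CU) (hG : PolyLipGrowth CU gA P q) (hP : 0 ≤ P)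
    (h5 : NE5 EA EB W κ θ₅ C₅) (hθ₅ : 0 ≤ θ₅) (hC₅ : 0 ≤ C₅) (hθ₅' : θ₅ ≤ θ')
    {BA : BFunctional ({ toCarriers := occCarriers n L N ε dom D sc dl hdl, Fl := Fl, admFl := admFl } : T4BoundaryCarrier.Carriers)
        (occCarriers n L N ε dom D sc dl hdl).BgA}
    {BB : BFunctional ({ toCarriers := occCarriers n L N ε dom D sc dl hdl, Fl := Fl, admFl := admFl } : T4BoundaryCarrier.Carriers)
        (occCarriers n L N ε dom D sc dl hdl).BgB}
    {θ₅B C₅B PB : ℝ} {qB : ℕ} {CUB : (ℕ → ℝ) → ℕ → ℝ}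
    (h9B : NE9Fl BA W κ Λ) (hUBf : LipBackgroundFl BA W κ CUB) (hGB : PolyLipGrowth CUB gA PB qB) (hPB : 0 ≤ PB)
    (h5B : NE5B BA BB W κ θ₅B C₅B) (hθ₅B : 0 ≤ θ₅B) (hC₅B : 0 ≤ C₅B) (hθ₅B' : θ₅B ≤ θ')
    {RA : Functional ({ toCarriers := occCarriers n L N ε dom D sc dl hdl, Fl := Fl, admFl := admFl } :
        T4BoundaryCarrier.Carriers).toCarriers (occCarriers n L N ε dom D sc dl hdl).BgA}
    {RB : Functional ({ toCarriers := occCarriers n L N ε dom D sc dl hdl, Fl := Fl, admFl := admFl } :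
        T4BoundaryCarrier.Carriers).toCarriers (occCarriers n L N ε dom D sc dl hdl).BgB}
    {θ₅R C₅R PR : ℝ} {qR : ℕ} {CUR : (ℕ → ℝ) → ℕ → ℝ}
    (h9R : NE9 RA W κ Λ) (hUR' : LipBackground RA W κ CUR) (hGR : PolyLipGrowth CUR gA PR qR) (hPR : 0 ≤ PR)
    (h5R : NE5 RA RB W κ θ₅R C₅R) (hθ₅R : 0 ≤ θ₅R) (hC₅R : 0 ≤ C₅R) (hθ₅R' : θ₅R ≤ θ')
    -- (D) the term-wise END's own data and remaining binders (`TermwiseLocalThm1LedgerW` ll.97–242, `ι :=` configurations, `Adm := dom`)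
    [MeasurableSpace (Site 4 → Fin 4 → (Matrix n n ℂ)ˣ)] {σ : Type*} [DecidableEq σ] {l₀ vol : ℝ}
    {T : ℕ → Finset σ} {Bad : ℕ → ℝ → Finset σ} {A B : ℕ → ℝ → σ → ℝ} {μ : ℕ → ℝ → σ → Measure (Site 4 → Fin 4 → (Matrix n n ℂ)ˣ)}
    {fac bfac rfac : ℕ → ℝ → σ → Finset D} {R₁ bβ β' w₀ : ℝ} {κ₀ : ℕ} {gfA gfB : ℕ → ℝ} {gsA gsB : ℕ → ℕ → ℝ}
    {pend : ℕ → ℝ → σ → (Site 4 → Fin 4 → (Matrix n n ℂ)ˣ) → Fl}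
    {nA nB aA aB wA wB γA γB : ℕ → ℝ → σ → (Site 4 → Fin 4 → (Matrix n n ℂ)ˣ) → ℝ} {qA qB : ℕ → ℝ}
    {κ₁ S : ℕ → ℝ → σ → ℕ → ℝ} {cW' RW' : ℕ → ℝ → σ → ℝ} {rw' sw' rγ zA zB c₀' : ℕ → ℝ} {Cw E a Λg Cl CF Ew CrW : ℝ}
    {Y YA : Type*} {Sfib : ℕ → ℝ → σ → (Site 4 → Fin 4 → (Matrix n n ℂ)ˣ) → Set Y}
    {SfibA : ℕ → ℝ → σ → (Site 4 → Fin 4 → (Matrix n n ℂ)ˣ) → Set YA} {gfib : ℕ → ℝ → σ → (Site 4 → Fin 4 → (Matrix n n ℂ)ˣ) → YA → ℝ}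
    {f₁ : ℕ → ℝ → σ → (Site 4 → Fin 4 → (Matrix n n ℂ)ˣ) → Y → ℝ}
    {Q : ℕ → ℝ → σ → (Site 4 → Fin 4 → (Matrix n n ℂ)ˣ) → Y → YA} {yA yB : ℕ → ℝ → σ → (Site 4 → Fin 4 → (Matrix n n ℂ)ˣ) → Y}
    {xA : ℕ → ℝ → σ → (Site 4 → Fin 4 → (Matrix n n ℂ)ˣ) → YA}
    (M : ℕ) (hMtwo : 2 ≤ M) (planes : Finset (Fin 4 × Fin 4))
    (hplanes : ∀ P ∈ planes, P.1 ≠ P.2)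
    (famA famB : ℕ → ℝ → σ → (Site 4 → Fin 4 → (Matrix n n ℂ)ˣ) → VarProblem)
    (ρA : ∀ K t τ v, Realises (famA K t τ v) 4 (Matrix n n ℂ)) (ρB : ∀ K t τ v, Realises (famB K t τ v) 4 (Matrix n n ℂ))
    (UA : ∀ K t τ v, (famA K t τ v).Cfg) (UB : ∀ K t τ v, (famB K t τ v).Cfg)
    (lvlA lvlB : ℕ → ℝ → σ → (Site 4 → Fin 4 → (Matrix n n ℂ)ˣ) → (Fin 4 × Fin 4) × B7Prop1Explicit.Site 4 → ℕ)
    (Cst : B11Thm1.Consts) {Mc ε₁ β₀ : ℝ}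
    (hθ'Λ : θ' ≤ Λg) (hΛ1 : 1 ≤ Λg) (hCl : 0 ≤ Cl)
    -- the residue of the residual-proper factor (W-fmt), read by `hWw′` below
    (wA' wB' : ℕ → ℝ → σ → (Site 4 → Fin 4 → (Matrix n n ℂ)ˣ) → ℝ)
    -- THE EIGHT SELECTION-READING BINDERS, for EVERY selection with the gen-56 specification
    (hO : ∀ (uA : ℕ → (Site 4 → Fin 4 → (Matrix n n ℂ)ˣ) → (occCarriers n L N ε dom D sc dl hdl).BgA)
        (uB : ℕ → (Site 4 → Fin 4 → (Matrix n n ℂ)ˣ) → (occCarriers n L N ε dom D sc dl hdl).BgB)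
        (oneA : (occCarriers n L N ε dom D sc dl hdl).BgA) (oneB : (occCarriers n L N ε dom D sc dl hdl).BgB),
      -- (a) gauge copies of a minimiser pair for the datum itself, at EVERY cutoff, on `dom ∖ {v₁}`
      (∀ K : ℕ, ∀ v ∈ dom, v ≠ v₁ → ∃ (U₁ U₂ : (Site 4 → Fin 4 → (Matrix n n ℂ)ˣ)) (w₁ w₂ : Site 4 → (Matrix n n ℂ)ˣ),
        IsMinimiser 4 (sfClass 4 L N ε) L N K v U₁ ∧ IsMinimiser 4 (sfClass 4 L N ε) L N (K + 1) v U₂ ∧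
        Regular 4 L N ε g (K + 1) U₂ ∧ IsUnitarySite w₁ ∧ IsPeriodicSite w₁ ((N * L ^ K : ℕ) : ℤ) ∧
        IsUnitarySite w₂ ∧ IsPeriodicSite w₂ ((N * L ^ (K + 1) : ℕ) : ℤ) ∧
        (uA K v).1 = (K, gaugeAct w₁ U₁) ∧ (uB K v).1 = (K, gaugeAct w₂ U₂)) →
      -- (b) the reference backgrounds at `v₁` and off `dom`; they are the flat configuration at tag `0`
      (∀ (K : ℕ) (v : (Site 4 → Fin 4 → (Matrix n n ℂ)ˣ)), ¬ (v ∈ dom ∧ v ≠ v₁) → uA K v = oneA ∧ uB K v = oneB) →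
      oneA.1 = ((0 : ℕ), (1 : Site 4 → Fin 4 → (Matrix n n ℂ)ˣ)) → oneB.1 = ((0 : ℕ), (1 : Site 4 → Fin 4 → (Matrix n n ℂ)ˣ)) →
      -- `hfmtA` (l.97)
      (∀ K t τ, A K t τ = ∫ v, (∏ X ∈ fac K t τ,
        Real.exp (EA (gA K) (uA K v) X - EA (gA K) oneA X)) *
          ((∏ X ∈ bfac K t τ, Real.exp (BA (gA K) (uA K v) (pend K t τ v) X)) * nA K t τ v * qA K *
            ((∏ X ∈ rfac K t τ, Real.exp (RA (gA K) (uA K v) X - RA (gA K) oneA X)) * (Real.exp (-aA K t τ v) * wA K t τ v)))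
            ∂(μ K t τ)) ∧
      -- `hfmtB` (l.102)
      (∀ K t τ, B K t τ = ∫ v, (∏ X ∈ fac K t τ,
        Real.exp (EB (fun i => gA (K + 1) (i + 1)) (uB K v) X - EB (fun i => gA (K + 1) (i + 1)) oneB X)) *
          ((∏ X ∈ bfac K t τ, Real.exp (BB (fun i => gA (K + 1) (i + 1)) (uB K v) (pend K t τ v) X)) * nB K t τ v * qB K *
            ((∏ X ∈ rfac K t τ, Real.exp (RB (fun i => gA (K + 1) (i + 1)) (uB K v) X - RB (fun i => gA (K + 1) (i + 1)) oneB X)) *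
              (Real.exp (-aB K t τ v) * wB K t τ v)))
            ∂(μ K t τ)) ∧
      -- `hint` (l.107)
      (∀ K t, |t| ≤ l₀ → ∀ τ ∈ T K \ Bad K t,
        Integrable (fun v => (∏ X ∈ fac K t τ, Real.exp (EA (gA K) (uA K v) X - EA (gA K) oneA X)) *
          ((∏ X ∈ bfac K t τ, Real.exp (BA (gA K) (uA K v) (pend K t τ v) X)) * nA K t τ v * qA K *
            ((∏ X ∈ rfac K t τ, Real.exp (RA (gA K) (uA K v) X - RA (gA K) oneA X)) * (Real.exp (-aA K t τ v) * wA K t τ v))))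
            (μ K t τ) ∧
        Integrable (fun v => (∏ X ∈ fac K t τ,
            Real.exp (EB (fun i => gA (K + 1) (i + 1)) (uB K v) X - EB (fun i => gA (K + 1) (i + 1)) oneB X)) *
          ((∏ X ∈ bfac K t τ, Real.exp (BB (fun i => gA (K + 1) (i + 1)) (uB K v) (pend K t τ v) X)) * nB K t τ v * qB K *
            ((∏ X ∈ rfac K t τ, Real.exp (RB (fun i => gA (K + 1) (i + 1)) (uB K v) X - RB (fun i => gA (K + 1) (i + 1)) oneB X)) *
              (Real.exp (-aB K t τ v) * wB K t τ v))))
            (μ K t τ)) ∧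
      -- `hoff` (l.117)
      (∀ K t, |t| ≤ l₀ → ∀ τ ∈ T K \ Bad K t, ∀ v, v ∉ dom →
        (∏ X ∈ fac K t τ, Real.exp (EA (gA K) (uA K v) X - EA (gA K) oneA X)) *
          ((∏ X ∈ bfac K t τ, Real.exp (BA (gA K) (uA K v) (pend K t τ v) X)) * nA K t τ v * qA K *
            ((∏ X ∈ rfac K t τ, Real.exp (RA (gA K) (uA K v) X - RA (gA K) oneA X)) * (Real.exp (-aA K t τ v) * wA K t τ v)))
            = 0 ∧
        (∏ X ∈ fac K t τ, Real.exp (EB (fun i => gA (K + 1) (i + 1)) (uB K v) X - EB (fun i => gA (K + 1) (i + 1)) oneB X)) *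
          ((∏ X ∈ bfac K t τ, Real.exp (BB (fun i => gA (K + 1) (i + 1)) (uB K v) (pend K t τ v) X)) * nB K t τ v * qB K *
            ((∏ X ∈ rfac K t τ, Real.exp (RB (fun i => gA (K + 1) (i + 1)) (uB K v) X - RB (fun i => gA (K + 1) (i + 1)) oneB X)) *
              (Real.exp (-aB K t τ v) * wB K t τ v)))
            = 0) ∧
      -- `hS` (l.126)
      (∀ K t, |t| ≤ l₀ → ∀ τ ∈ T K \ Bad K t, ∀ v ∈ dom, ∀ j ≤ K,
        |(∑ X ∈ fac K t τ with sc X = j,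
            (Real.log (Real.exp (EB (fun i => gA (K + 1) (i + 1)) (uB K v) X - EB (fun i => gA (K + 1) (i + 1)) oneB X))
              - Real.log (Real.exp (EA (gA K) (uA K v) X - EA (gA K) oneA X)))) - κ₁ K t τ j| ≤ S K t τ j) ∧
      -- `hRSA` (l.148), `hRSB` (l.150)
      (∀ K t, |t| ≤ l₀ → ∀ τ ∈ T K \ Bad K t, ∀ v ∈ dom, ∀ j ≤ K,
        |∑ X ∈ rfac K t τ with sc X = j, (RA (gA K) (uA K v) X - RA (gA K) oneA X)| ≤ vol * (R₁ * gsA K j ^ κ₀)) ∧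
      (∀ K t, |t| ≤ l₀ → ∀ τ ∈ T K \ Bad K t, ∀ v ∈ dom, ∀ j ≤ K,
        |∑ X ∈ rfac K t τ with sc X = j,
          (RB (fun i => gA (K + 1) (i + 1)) (uB K v) X - RB (fun i => gA (K + 1) (i + 1)) oneB X)| ≤ vol * (R₁ * gsB K j ^ κ₀)) ∧
      -- `hWw′` (l.222)
      (∀ K t, |t| ≤ l₀ → ∀ τ ∈ T K \ Bad K t, ∀ v ∈ dom, uA K v = oneA → uB K v = oneB →
        |Real.log (wB' K t τ v) - Real.log (wA' K t τ v) - c₀' K| ≤ vol * sw' K))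
    -- the END's selection-free binders, VERBATIM
    (hsc : ∀ K t, |t| ≤ l₀ → ∀ τ ∈ T K \ Bad K t, ∀ X ∈ fac K t τ, sc X ≤ K)
    (hM : ∀ K t, |t| ≤ l₀ → ∀ τ ∈ T K \ Bad K t,
      Multiplicity (fac K t τ) sc (fun X => Real.exp (-(κ * dl X))) Cw vol Λg K)
    (hvol : 0 ≤ vol) (hE : 0 ≤ E) (ha0 : 0 < a) (ha1 : a < 1)
    (hSle : ∀ K t, |t| ≤ l₀ → ∀ τ ∈ T K \ Bad K t, ∀ j ≤ K, S K t τ j ≤ vol * (E * a ^ (K - j)))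
    (hpend : ∀ K t, |t| ≤ l₀ → ∀ τ ∈ T K \ Bad K t, ∀ v ∈ dom, pend K t τ v ∈ admFl)
    (hBwin : ∀ K t, |t| ≤ l₀ → ∀ τ ∈ T K \ Bad K t, RecentOnly (bfac K t τ) sc (jlogOf Cl K) K)
    (hMB : ∀ K t, |t| ≤ l₀ → ∀ τ ∈ T K \ Bad K t,
      Multiplicity (bfac K t τ) sc (fun X => Real.exp (-(κ * dl X))) Cw vol Λg K)
    (hnpos : ∀ K t, |t| ≤ l₀ → ∀ τ ∈ T K \ Bad K t, ∀ v ∈ dom, 0 < nA K t τ v ∧ 0 < nB K t τ v)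
    (hzA : ∀ K t, |t| ≤ l₀ → ∀ τ ∈ T K \ Bad K t, ∀ v ∈ dom, |Real.log (nA K t τ v)| ≤ vol * zA K)
    (hzB : ∀ K t, |t| ≤ l₀ → ∀ τ ∈ T K \ Bad K t, ∀ v ∈ dom, |Real.log (nB K t τ v)| ≤ vol * zB K)
    (hzAs : Summable zA) (hzBs : Summable zB)
    (hq : ∀ K, 0 < qA K ∧ 0 < qB K)
    (hrsc : ∀ K t, |t| ≤ l₀ → ∀ τ ∈ T K \ Bad K t, ∀ X ∈ rfac K t τ, sc X ≤ K)
    (hMR : ∀ K t, |t| ≤ l₀ → ∀ τ ∈ T K \ Bad K t,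
      Multiplicity (rfac K t τ) sc (fun X => Real.exp (-(κ * dl X))) Cw vol Λg K)
    (hbβ : 0 < bβ) (h031A : ∀ K, Step.Discrete031 bβ β' K (gfA K) (gsA K))
    (h031B : ∀ K, Step.Discrete031 bβ β' K (gfB K) (gsB K)) (hgsA : ∀ K k, k ≤ K → 0 ≤ gsA K k)
    (hgsB : ∀ K k, k ≤ K → 0 ≤ gsB K k) (hR₁ : 0 ≤ R₁) (hκ₀ : 4 < κ₀)
    (hminA : ∀ K t, |t| ≤ l₀ → ∀ τ ∈ T K \ Bad K t, ∀ v ∈ dom, IsMinOn (gfib K t τ v) (SfibA K t τ v) (xA K t τ v))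
    (hQ : ∀ K t, |t| ≤ l₀ → ∀ τ ∈ T K \ Bad K t, ∀ v ∈ dom, Set.MapsTo (Q K t τ v) (Sfib K t τ v) (SfibA K t τ v))
    (hlift : ∀ K t, |t| ≤ l₀ → ∀ τ ∈ T K \ Bad K t, ∀ v ∈ dom,
      yA K t τ v ∈ Sfib K t τ v ∧ Q K t τ v (yA K t τ v) = xA K t τ v)
    (hminB : ∀ K t, |t| ≤ l₀ → ∀ τ ∈ T K \ Bad K t, ∀ v ∈ dom,
      yB K t τ v ∈ Sfib K t τ v ∧ IsMinOn (f₁ K t τ v) (Sfib K t τ v) (yB K t τ v))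
    (hact : ∀ K t, |t| ≤ l₀ → ∀ τ ∈ T K \ Bad K t, ∀ v ∈ dom,
      aA K t τ v = w₀ * gfib K t τ v (xA K t τ v) + γA K t τ v ∧
        aB K t τ v = w₀ * f₁ K t τ v (yB K t τ v) + γB K t τ v)
    (hw₀ : 0 ≤ w₀)
    (hAU : ∀ K t, |t| ≤ l₀ → ∀ τ ∈ T K \ Bad K t, ∀ v ∈ dom,
      (∀ x κ, (ρA K t τ v).cfg (UA K t τ v) x κ ∈ unitaryUnits (Matrix n n ℂ)) ∧
        IsPeriodic (M * L ^ K * L) ((ρA K t τ v).cfg (UA K t τ v)))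
    (hBU : ∀ K t, |t| ≤ l₀ → ∀ τ ∈ T K \ Bad K t, ∀ v ∈ dom,
      (∀ x κ, (ρB K t τ v).cfg (UB K t τ v) x κ ∈ unitaryUnits (Matrix n n ℂ)) ∧
        IsPeriodic (M * L ^ K * L) ((ρB K t τ v).cfg (UB K t τ v)))
    (hPLA : ∀ K t τ v, (famA K t τ v).L = (L : ℝ)) (hetaA : ∀ K t τ v, (famA K t τ v).eta = ((L : ℝ) ^ K)⁻¹)
    (hPLB : ∀ K t τ v, (famB K t τ v).L = (L : ℝ)) (hetaB : ∀ K t τ v, (famB K t τ v).eta = ((L : ℝ) ^ K)⁻¹)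
    (hTA : ∀ K t τ v, B11Thm1.Thm1At Cst (famA K t τ v)) (hTB : ∀ K t τ v, B11Thm1.Thm1At Cst (famB K t τ v))
    (hε₁a : ε₁ ≤ Cst.a₁) (VbA : ∀ K t τ v, (famA K t τ v).Bdry) (VbB : ∀ K t τ v, (famB K t τ v).Bdry)
    (hVbA : ∀ K t τ v, (famA K t τ v).Reg7 ε₁ (VbA K t τ v)) (hVbB : ∀ K t τ v, (famB K t τ v).Reg7 ε₁ (VbB K t τ v))
    (hUA : ∀ K t τ v, (famA K t τ v).OnMinimalOrbit (Cst.B₃ * ε₁) (VbA K t τ v) (UA K t τ v))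
    (hUB : ∀ K t τ v, (famB K t τ v).OnMinimalOrbit (Cst.B₃ * ε₁) (VbB K t τ v) (UB K t τ v))
    (hMc0 : 0 ≤ Mc) (hMc : Mc ≤ Cst.Mfun ε₁)
    (hlvlA : ∀ K t τ v, ∀ y ∈ pbox planes (M * L ^ K), lvlA K t τ v y ≤ K)
    (hlvlB : ∀ K t τ v, ∀ y ∈ pbox planes (M * L ^ K), lvlB K t τ v y ≤ K)
    (hcoverA : ∀ K t, |t| ≤ l₀ → ∀ τ ∈ T K \ Bad K t, ∀ v ∈ dom, ∀ y ∈ pbox planes (M * L ^ K),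
      ∀ x : B7Prop1Explicit.Site 4, InBox ((L : ℤ) • y.2) (deltaHi L ((L : ℤ) • y.2) y.1.1 y.1.2) x →
        ∃ cb : (famA K t τ v).Cube, (famA K t τ v).scale cb = lvlA K t τ v y ∧ (famA K t τ v).sizeM cb ≤ Mc ∧
          l1 (x - (ρA K t τ v).centre cb) + 6 ≤ (ρA K t τ v).radius cb)
    (hcoverB : ∀ K t, |t| ≤ l₀ → ∀ τ ∈ T K \ Bad K t, ∀ v ∈ dom, ∀ y ∈ pbox planes (M * L ^ K),
      ∀ x : B7Prop1Explicit.Site 4, InBox ((L : ℤ) • y.2) (deltaHi L ((L : ℤ) • y.2) y.1.1 y.1.2) x →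
        ∃ cb : (famB K t τ v).Cube, (famB K t τ v).scale cb = lvlB K t τ v y ∧ (famB K t τ v).sizeM cb ≤ Mc ∧
          l1 (x - (ρB K t τ v).centre cb) + 6 ≤ (ρB K t τ v).radius cb)
    (hwinA : ∀ K t, |t| ≤ l₀ → ∀ τ ∈ T K \ Bad K t, ∀ v ∈ dom,
      RecentOnly (pbox planes (M * L ^ K)) (lvlA K t τ v) (jlogOf Cl K) K)
    (hwinB : ∀ K t, |t| ≤ l₀ → ∀ τ ∈ T K \ Bad K t, ∀ v ∈ dom,
      RecentOnly (pbox planes (M * L ^ K)) (lvlB K t τ v) (jlogOf Cl K) K)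
    (hε₁ : 0 < ε₁) (hε₁1 : ε₁ ≤ 1)
    (hsmall : 20480 * (L : ℝ) ^ 2 * (cReg (Cst.B₃ * Mc) (Cst.B₃ * Mc) * ε₁) ≤ 1) (hβ₀ : 0 < β₀) (hβ₀1 : β₀ ≤ 1)
    (hreprU : ∀ K t, |t| ≤ l₀ → ∀ τ ∈ T K \ Bad K t, ∀ v ∈ dom,
      f₁ K t τ v (yA K t τ v) = ∑ x ∈ pbox planes (M * L ^ K * L), eN (phiU ((ρA K t τ v).cfg (UA K t τ v)) x) ∧
        gfib K t τ v (xA K t τ v) = ∑ y ∈ pbox planes (M * L ^ K), eN (psiU L ((ρA K t τ v).cfg (UA K t τ v)) y))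
    (hreprL : ∀ K t, |t| ≤ l₀ → ∀ τ ∈ T K \ Bad K t, ∀ v ∈ dom,
      f₁ K t τ v (yB K t τ v) = ∑ x ∈ pbox planes (M * L ^ K * L), eN (phiU ((ρB K t τ v).cfg (UB K t τ v)) x) ∧
        gfib K t τ v (Q K t τ v (yB K t τ v)) = ∑ y ∈ pbox planes (M * L ^ K), eN (psiU L ((ρB K t τ v).cfg (UB K t τ v)) y))
    (hMvol : ((M : ℝ)) ^ 4 ≤ vol)
    (hγ : ∀ K t, |t| ≤ l₀ → ∀ τ ∈ T K \ Bad K t, ∀ v ∈ dom, |γB K t τ v - γA K t τ v| ≤ vol * rγ K)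
    (hrγ : Summable rγ)
    -- the residual-proper factor's format (W-fmt) and inputs (W-sc)(W-loc)(W-size)(W-rate-t)(W-mult-F)(W-win)(W-rate-0)(W-mult)
    (wfac nf : ℕ → ℝ → σ → Finset D) (wfac₀ : ℕ → Finset D)
    (vcA vcB : ℕ → ℝ → D → ℝ) (hEw : 0 ≤ Ew) (hCrW : 0 ≤ CrW)
    (hwA : ∀ K t, |t| ≤ l₀ → ∀ τ ∈ T K \ Bad K t, ∀ v ∈ dom,
      wA K t τ v = wA' K t τ v * Real.exp (∑ X ∈ wfac K t τ, vcA K t X))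
    (hwB : ∀ K t, |t| ≤ l₀ → ∀ τ ∈ T K \ Bad K t, ∀ v ∈ dom,
      wB K t τ v = wB' K t τ v * Real.exp (∑ X ∈ wfac K t τ, vcB K t X))
    (hw'pos : ∀ K t, |t| ≤ l₀ → ∀ τ ∈ T K \ Bad K t, ∀ v ∈ dom, 0 < wA' K t τ v ∧ 0 < wB' K t τ v)
    (hRw' : ∀ K t, |t| ≤ l₀ → ∀ τ ∈ T K \ Bad K t, ∀ v ∈ dom,
      |Real.log (wB' K t τ v) - Real.log (wA' K t τ v) - cW' K t τ| ≤ RW' K t τ)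
    (hRRw' : ∀ K t, |t| ≤ l₀ → ∀ τ ∈ T K \ Bad K t, RW' K t τ ≤ vol * rw' K) (hrw' : Summable rw')
    (hsw' : Summable sw')
    (hWsc : ∀ K t, |t| ≤ l₀ → ∀ τ ∈ T K \ Bad K t, ∀ X ∈ wfac K t τ, sc X ≤ K)
    (hWsc₀ : ∀ K, ∀ X ∈ wfac₀ K, sc X ≤ K)
    (hWloc : ∀ K t, |t| ≤ l₀ → ∀ τ ∈ T K \ Bad K t, ∀ X ∈ wfac K t τ, X ∉ nf K t τ →
      vcA K t X = vcA K 0 X ∧ vcB K t X = vcB K 0 X)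
    (hWsize : ∀ K t, |t| ≤ l₀ → ∀ τ ∈ T K \ Bad K t, ∀ j ≤ K,
      ∑ X ∈ wfac K t τ with sc X = j, (|vcA K t X - vcA K 0 X| + |vcB K t X - vcB K 0 X|)
        ≤ vol * (Ew * a ^ (K - j)))
    (hWratet : ∀ K t, |t| ≤ l₀ → ∀ τ ∈ T K \ Bad K t, ∀ X ∈ wfac K t τ, X ∈ nf K t τ →
      |(vcB K t X - vcB K 0 X) - (vcA K t X - vcA K 0 X)| ≤ CrW * θ' ^ sc X * Real.exp (-(κ * dl X)))
    (hWMF : ∀ K t, |t| ≤ l₀ → ∀ τ ∈ T K \ Bad K t,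
      Multiplicity (nf K t τ) sc (fun X => Real.exp (-(κ * dl X))) CF vol Λg K)
    (hWwin : ∀ K t, |t| ≤ l₀ → ∀ τ ∈ T K \ Bad K t, ∀ X ∈ wfac K t τ, X ∉ wfac₀ K → jlogOf Cl K ≤ sc X)
    (hWwin₀ : ∀ K t, |t| ≤ l₀ → ∀ τ ∈ T K \ Bad K t, ∀ X ∈ wfac₀ K, X ∉ wfac K t τ → jlogOf Cl K ≤ sc X)
    (hWrate0 : ∀ K t, |t| ≤ l₀ → ∀ τ ∈ T K \ Bad K t, ∀ X ∈ wfac K t τ,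
      |vcB K 0 X - vcA K 0 X| ≤ CrW * θ' ^ sc X * Real.exp (-(κ * dl X)))
    (hWrate0' : ∀ K, ∀ X ∈ wfac₀ K, |vcB K 0 X - vcA K 0 X| ≤ CrW * θ' ^ sc X * Real.exp (-(κ * dl X)))
    (hWM : ∀ K t, |t| ≤ l₀ → ∀ τ ∈ T K \ Bad K t,
      Multiplicity (wfac K t τ) sc (fun X => Real.exp (-(κ * dl X))) Cw vol Λg K)
    (hWM₀ : ∀ K, Multiplicity (wfac₀ K) sc (fun X => Real.exp (-(κ * dl X))) Cw vol Λg K),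
    ∃ δ : ℕ → ℝ, GoodClause l₀ vol T A B Bad δ ∧ Summable δ := by
  obtain ⟨ε₁, hε₁, H1⟩ := goodClause_summable_of_route1_docked_smallData_SU2EG (n := n) hn
  obtain ⟨ε₂, hε₂, H2⟩ := ne3EnergyGradRateWSup_SU2_smallData (n := n) hn
  refine ⟨min ε₁ ε₂, lt_min hε₁ hε₂, ?_⟩
  intro L N hL2 hN ε hε hεle
  obtain ⟨δ₁, hδ₁, H1'⟩ := H1 hL2 hN hε (hεle.trans (min_le_left _ _))
  subst hL2
  haveI : NeZero N := ⟨by omega⟩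
  obtain ⟨δ₂, hδ₂, H2'⟩ := H2 ε hε (hεle.trans (min_le_right _ _)) N hN
  refine ⟨min δ₁ δ₂, lt_min hδ₁ hδ₂, ?_⟩
  intro θ hθ hθ18 g hgE dom hdom hdomδ c hc hreg10
  -- the printed gradient letter `g > 0`
  have hg : 0 < g := by
    rw [hgE]
    have hcard : (0 : ℝ) < (Fintype.card n : ℝ) := by rw [hn]; norm_num
    positivity
  -- the two radii of the small data
  have hdomδ₁ : ∀ v ∈ dom, IsUnitaryCfg v ∧ IsPeriodicCfg v (N : ℤ) ∧ SmallField v δ₁ := fun v hv =>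
    ⟨(hdomδ v hv).1, (hdomδ v hv).2.1, MinimalActionRate.SmallField.mono (hdomδ v hv).2.2 (min_le_left _ _)⟩
  have hdom₂ : dom ⊆ {V : Site 4 → Fin 4 → (Matrix n n ℂ)ˣ | IsUnitaryCfg V ∧ IsPeriodicCfg V (N : ℤ) ∧ SmallField V δ₂} := fun v hv =>
    ⟨(hdomδ v hv).1, (hdomδ v hv).2.1, MinimalActionRate.SmallField.mono (hdomδ v hv).2.2 (min_le_right _ _)⟩
  -- THE SOCKET `h_EG` IS A THEOREM MODULO (10) TYPE (this generation's supplier)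
  obtain ⟨C, ΛG, -, -, HS⟩ := H2' g c hg hc θ hθ hθ18
  have h : ∀ k : ℕ, 1 ≤ k → ∀ V ∈ dom, ∀ UA UB : Site 4 → Fin 4 → (Matrix n n ℂ)ˣ,
      IsMinimiser 4 (sfClass 4 2 N ε) 2 N k V UA → IsMinimiser 4 (sfClass 4 2 N ε) 2 N (k + 1) V UB →
        Regular 4 2 N ε g (k + 1) UB →
        ∃ (u : Site 4 → (Matrix n n ℂ)ˣ) (Z : Site 4 → Fin 4 → Matrix n n ℂ),
          IsUnitarySite u ∧ IsPeriodicSite u ((N * 2 ^ k : ℕ) : ℤ) ∧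
          IsSkewDir Z ∧ IsPeriodicDir Z ((N * 2 ^ k : ℕ) : ℤ) ∧
          gaugeAct u UA = vary (rescale 2 (bavg 2 UB)) Z 1 ∧
          energyNormW 2 k (rescale 2 (bavg 2 UB)) Z (periodBox (N * 2 ^ k)) ≤ C * residualScale 4 2 N ε g k ∧
          (∀ (κ : Fin 4) (x : Site 4) (μ : Fin 4),
            ‖Ad (rescale 2 (bavg 2 UB) (x + e κ) μ) (Z (x + e μ) κ) - Z x κ‖ ≤ ΛG * θ ^ (38 * k)) := by
    intro k hk V hV UA UB hA hB hreg
    exact HS dom hdom₂ k hk V hV UA UB hA hB hreg (hreg10 V hV k UA hA) (hreg10 V hV (k + 1) UB hB)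
  exact H1' hθ hθ18 hgE hdom hdomδ₁ h

end

end Summit.QuantumFields.BalabanUV.T4Continuum.NE7Route1EndDockedSmallDataSU2Sup
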